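import Mathlib
import Summits.HodgeConjecture.HodgeConjecture.Theorems.TropicalWeilObstructionTropicalHodgeBoundClassesEigenwave

/-!
# The vertical fibre class is a tropical Hodge class exactly on the split locus

Cell `pub-hodge-tropical` (Hodge NEGATION SINK; scoped exploration, cap 2 seats; no summit claim), seat tropical-1 gen 13
(`prover-pub-hodge-tropical-1-g13-0`, 2026-08-23). Kernel companion of HOME `certificates/splitrigidity/` (Theorem R / Computation C,
K1-SCOPE §8c): the SIMPLEST entry of the rigidity table — the monomials `x⁴`, `y⁴`, i.e. the flat fibres `pt × X_A`, `X_A × pt` of the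
split eightfold `X_A × X_A` — done in the kernel, in the eigenwave coordinates of K3's files
(`TropicalHodgeBound.thetaClass_eigenwave`: a table `C : (Fin 4 → Fin 8) → (Fin 4 → Fin 8) → ℝ` is killed by the eigenwave iff
`Σ_m (-1)^m C(K' ∘ m̂, K'_m :: J') = 0` for all `K' : Fin 5 → Fin 8`, `J' : Fin 3 → Fin 8`).

Index maps `lo, hi : Fin 4 → Fin 8` with values `i` and `i + 4` are taken as hypotheses (`hlo`, `hhi`), so that nothing is defined.
For a real `8 × 8` period matrix `Q` write `A = Q[hi,hi]` and `B = Q[lo,hi]`; for a Weil period `Q = [[A,B],[-B,A]]` these are its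
blocks. The integer homology class `e_hi ⊗ e_hi ∈ ⋀⁴ℤ⁸ ⊗ ⋀⁴ℤ⁸` (period ⊗ slope coordinates) of the vertical fibre `{pt} × X_A ⊂
X_{A ⊕ A}` has, at the period `Q`, the `V ⊗ slope` table `𝔉⟦Q, hi⟧ (S, S') = det Q[S, hi] · det L[S']`, `L = L⟦hi⟧ = (e₄|e₅|e₆|e₇)`
(this is `⋀⁴Q · (e_hi ⊗ e_hi)` in the `compound`/`hodgeClasses` vocabulary of
`Literature/AlgebraicGeometry/Tropical/TropicalTorusWeilCycles.lean`; both are display-only local notations here). Results: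
* `fibreTable_eigenwave_of_upperRight_eq_zero` — if `B = 0` the table is killed by the eigenwave (it is then the cell table of the
  frame `L` twisted by `A`, and the tree's pair identity `TropicalHodgeBound.sum_det_mul_submatrix_mul_det_submatrix_cons_eq_zero` applies);
* `upperRight_eq_zero_of_fibreTable_eigenwave` — conversely, if `det A ≠ 0` and the table is killed by the eigenwave then `B = 0`
  (the eigenwave sums at `K' = hi i :: hi[i ↦ lo k]`, `J' = hi ∘ î` isolate `± det A[i ↦ B_k]`; Cramer/adjugate);
* `fibreTable_eigenwave_iff` — the equivalence: **the fibre class is a tropical Hodge class at `Q` iff `B = 0`**, i.e. exactly on the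
  split locus. This is the (exact, not only first-order) Hodge-rigidity of the monomials `x⁴, y⁴` in every Weil direction `T ≠ 0`
  (Computation C, rows `xxxx`, `yyyy`) — the tropical form of "`E × pt` deforms with `E × E'` only while the surface stays split".
HONEST STATUS. Linear algebra at arbitrary (in particular NON-generic) periods; it supports the crux K1 (`TropicalWeilVanishing`,
stmt-HodgeConjecture-18478, OPEN) only as an ingredient of the split-point rigidity analysis; it decides nothing about K1 or K1_∂ and
nothing here bears on the Hodge conjecture. Nothing is defined; no named fact; no sorry.
References: [Zharkov2020TropicalWeil] I. Zharkov, arXiv:2002.02347, p. 2 (Hodge classes = kernel of the eigenwave);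
[MikhalkinZharkov2014Eigenwave] G. Mikhalkin, I. Zharkov, LN UMI 15 (2014), §5.1, Thm. 5.4.
-/

set_option linter.dupNamespace false

noncomputable section

open scoped BigOperators
open Matrix

namespace Summit.HodgeConjecture.HodgeConjecture.Theorems.TropicalWeilVanishing.SplitRigidity

/-! ## §0 Display-only notation (nothing is defined) -/

/-- `L⟦hi⟧ = (e_{hi 0} | … | e_{hi 3})`, the real `8 × 4` frame of the vertical fibre. -/
local notation3 (prettyPrint := false) "L⟦" hi "⟧" =>
  (Matrix.of fun (a : Fin (2 * 4)) (b : Fin 4) => if a = hi b then (1 : ℝ) else 0)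

/-- `𝔉⟦Q, hi⟧ (S, S') = det Q[S, hi] · det L⟦hi⟧[S']`: the `V ⊗ slope` table of `e_hi ⊗ e_hi` at the period `Q`. -/
local notation3 (prettyPrint := false) "𝔉⟦" Q "," hi "⟧" =>
  (fun S S' : Fin 4 → Fin (2 * 4) =>
    Matrix.det (Matrix.submatrix Q S hi) * Matrix.det (Matrix.submatrix (L⟦hi⟧) S' id))

section

/-- An index map `hi` with values `i + 4` is injective. [folklore] -/
theorem hi_injective (hi : Fin 4 → Fin (2 * 4)) (hhi : ∀ i, (hi i : ℕ) = i + 4) : Function.Injective hi := by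
  intro a b h
  have := congrArg (fun x : Fin (2 * 4) => (x : ℕ)) h
  simp only [hhi] at this
  exact Fin.ext (by omega)

/-- `L⟦hi⟧[hi, ·] = 1`. [folklore] -/
theorem fibreFrame_submatrix_hi (hi : Fin 4 → Fin (2 * 4)) (hhi : ∀ i, (hi i : ℕ) = i + 4) :
    (L⟦hi⟧).submatrix hi id = (1 : Matrix (Fin 4) (Fin 4) ℝ) := by
  ext a b
  simp only [Matrix.submatrix_apply, Matrix.of_apply, id, Matrix.one_apply,
    (hi_injective hi hhi).eq_iff]

/-- The rows `lo k` of `L⟦hi⟧` vanish. [folklore] -/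
theorem fibreFrame_lo (lo hi : Fin 4 → Fin (2 * 4)) (hlo : ∀ i, (lo i : ℕ) = i) (hhi : ∀ i, (hi i : ℕ) = i + 4)
    (k : Fin 4) (c : Fin 4) : (L⟦hi⟧) (lo k) c = 0 := by
  simp only [Matrix.of_apply]
  rw [if_neg]
  intro h
  have := congrArg (fun x : Fin (2 * 4) => (x : ℕ)) h
  simp only [hlo, hhi] at this
  omega

/-- If the upper-right block vanishes, `Q[S, hi] = (L · A)[S, ·]` with `A = Q[hi, hi]`. [folklore] -/
theorem submatrix_hi_eq_of_upperRight_eq_zero (lo hi : Fin 4 → Fin (2 * 4)) (hlo : ∀ i, (lo i : ℕ) = i)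
    (hhi : ∀ i, (hi i : ℕ) = i + 4) (Q : Matrix (Fin (2 * 4)) (Fin (2 * 4)) ℝ)
    (hB : ∀ i j : Fin 4, Q (lo i) (hi j) = 0) (S : Fin 4 → Fin (2 * 4)) :
    Q.submatrix S hi = ((L⟦hi⟧) * Q.submatrix hi hi).submatrix S id := by
  ext a b
  simp only [Matrix.submatrix_apply, Matrix.mul_apply, id, Matrix.of_apply]
  by_cases h : (S a : ℕ) < 4
  · -- row in the lower block: both sides vanish
    have hS : S a = lo ⟨S a, h⟩ := Fin.ext (by simp [hlo])
    rw [hS, hB]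
    symm
    refine Finset.sum_eq_zero fun c _ => ?_
    have h0 := fibreFrame_lo lo hi hlo hhi ⟨S a, h⟩ c
    simp only [Matrix.of_apply] at h0
    rw [h0, zero_mul]
  · -- row in the upper block: `S a = hi c₀`
    have hlt := (S a).2
    have hS : S a = hi ⟨(S a : ℕ) - 4, by omega⟩ := Fin.ext (by simp [hhi]; omega)
    rw [Finset.sum_eq_single (⟨(S a : ℕ) - 4, by omega⟩ : Fin 4)]
    · rw [if_pos hS, one_mul, ← hS]
    · intro c _ hc
      rw [if_neg, zero_mul]
      intro hh
      apply hc
      apply hi_injective hi hhi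
      rw [← hh, ← hS]
    · intro h'; exact absurd (Finset.mem_univ _) h'

/-- **If `B = 0` the fibre class is killed by the eigenwave**: every eigenwave sum of `𝔉⟦Q, hi⟧` vanishes.
[cite: MikhalkinZharkov2014Eigenwave, Thm. 5.4] -/
theorem fibreTable_eigenwave_of_upperRight_eq_zero (lo hi : Fin 4 → Fin (2 * 4)) (hlo : ∀ i, (lo i : ℕ) = i)
    (hhi : ∀ i, (hi i : ℕ) = i + 4) (Q : Matrix (Fin (2 * 4)) (Fin (2 * 4)) ℝ)
    (hB : ∀ i j : Fin 4, Q (lo i) (hi j) = 0) (K' : Fin 5 → Fin (2 * 4)) (J' : Fin 3 → Fin (2 * 4)) :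
    ∑ m : Fin 5, (-1 : ℝ) ^ (m : ℕ) *
      (𝔉⟦Q, hi⟧) (fun a => K' (m.succAbove a)) (Fin.cons (K' m) J') = 0 := by
  have h := TropicalHodgeBound.sum_det_mul_submatrix_mul_det_submatrix_cons_eq_zero
    (L⟦hi⟧) (Q.submatrix hi hi) K' J'
  refine Eq.trans (Finset.sum_congr rfl fun m _ => ?_) h
  beta_reduce
  rw [submatrix_hi_eq_of_upperRight_eq_zero lo hi hlo hhi Q hB (fun a => K' (m.succAbove a)), mul_assoc]

/-- The eigenwave sum at `K' = hi i :: hi[i ↦ lo k]`, `J' = hi ∘ î` has exactly one non-zero term: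
`det (A with row i replaced by B_k) · det L⟦hi⟧[hi i :: hi ∘ î]`. [folklore] -/
theorem eigenwave_sum_special (lo hi : Fin 4 → Fin (2 * 4)) (hlo : ∀ i, (lo i : ℕ) = i)
    (hhi : ∀ i, (hi i : ℕ) = i + 4) (Q : Matrix (Fin (2 * 4)) (Fin (2 * 4)) ℝ) (i k : Fin 4) :
    ∑ m : Fin 5, (-1 : ℝ) ^ (m : ℕ) *
      (𝔉⟦Q, hi⟧) (fun a => (Fin.cons (hi i) (fun a => if a = i then lo k else hi a) : Fin 5 → Fin (2 * 4))
        (m.succAbove a))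
        (Fin.cons ((Fin.cons (hi i) (fun a => if a = i then lo k else hi a) : Fin 5 → Fin (2 * 4)) m)
          (fun t => hi (i.succAbove t))) =
      ((Q.submatrix hi hi).updateRow i (fun j => Q (lo k) (hi j))).det *
        ((L⟦hi⟧).submatrix (Fin.cons (hi i) (fun t => hi (i.succAbove t)) : Fin 4 → Fin (2 * 4)) id).det := by
  rw [Fin.sum_univ_succ]
  have htail : ∀ a : Fin 4, (Fin.cons (hi i) (fun a => if a = i then lo k else hi a) : Fin 5 → Fin (2 * 4))
      ((0 : Fin 5).succAbove a) = if a = i then lo k else hi a := by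
    intro a
    rw [Fin.succAbove_zero, Fin.cons_succ]
  have hrest : ∑ a : Fin 4, (-1 : ℝ) ^ ((a.succ : Fin 5) : ℕ) *
      (𝔉⟦Q, hi⟧) (fun b => (Fin.cons (hi i) (fun a => if a = i then lo k else hi a) : Fin 5 → Fin (2 * 4))
        (a.succ.succAbove b))
        (Fin.cons ((Fin.cons (hi i) (fun a => if a = i then lo k else hi a) : Fin 5 → Fin (2 * 4)) a.succ)
          (fun t => hi (i.succAbove t))) = 0 := by
    refine Finset.sum_eq_zero fun a _ => ?_
    rw [Fin.cons_succ]
    beta_reduce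
    suffices hdet : ((L⟦hi⟧).submatrix
        (Fin.cons (if a = i then lo k else hi a) (fun t => hi (i.succAbove t)) : Fin 4 → Fin (2 * 4)) id).det = 0 by
      rw [hdet, mul_zero, mul_zero]
    by_cases hai : a = i
    · -- first row is the zero row `lo k` of `L`
      rw [if_pos hai, TropicalHodgeBound.det_submatrix_cons_eq_sum]
      refine Finset.sum_eq_zero fun c _ => ?_
      have h0 := fibreFrame_lo lo hi hlo hhi k c
      rw [h0, mul_zero, zero_mul]
    · -- the row `hi a` occurs twice
      rw [if_neg hai]
      obtain ⟨t, ht⟩ := Fin.exists_succAbove_eq hai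
      refine Matrix.det_zero_of_row_eq (i := (0 : Fin 4)) (j := t.succ) (Fin.succ_ne_zero t).symm ?_
      ext b
      simp only [Matrix.submatrix_apply, id, Fin.cons_zero, Fin.cons_succ, ht]
  rw [hrest, add_zero]
  have h1 : (-1 : ℝ) ^ (((0 : Fin 5)) : ℕ) = 1 := by simp
  rw [h1, one_mul]
  beta_reduce
  rw [Fin.cons_zero]
  congr 2
  ext a b
  simp only [Matrix.submatrix_apply, htail, Matrix.updateRow_apply]
  by_cases hai : a = i
  · rw [if_pos hai, if_pos hai]
  · rw [if_neg hai, if_neg hai]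

/-- The permuted identity `L⟦hi⟧[hi i :: hi ∘ î, ·]` is invertible (it is a permutation matrix). [folklore] -/
theorem det_fibreFrame_submatrix_cons_ne_zero (hi : Fin 4 → Fin (2 * 4)) (hhi : ∀ i, (hi i : ℕ) = i + 4) (i : Fin 4) :
    ((L⟦hi⟧).submatrix (Fin.cons (hi i) (fun t => hi (i.succAbove t)) : Fin 4 → Fin (2 * 4)) id).det ≠ 0 := by
  have hperm : (Fin.cons (hi i) (fun t => hi (i.succAbove t)) : Fin 4 → Fin (2 * 4)) =
      hi ∘ (i.cycleRange.symm : Fin 4 → Fin 4) := by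
    funext a
    refine Fin.cases ?_ (fun t => ?_) a
    · simp [Fin.cycleRange_symm_zero]
    · simp [Fin.cycleRange_symm_succ]
  rw [hperm]
  have : (L⟦hi⟧).submatrix (hi ∘ (i.cycleRange.symm : Fin 4 → Fin 4)) id =
      ((L⟦hi⟧).submatrix hi id).submatrix (i.cycleRange.symm : Fin 4 → Fin 4) id := by
    rw [Matrix.submatrix_submatrix, Function.comp_id]
  rw [this, fibreFrame_submatrix_hi hi hhi, Matrix.det_permute, Matrix.det_one, mul_one]
  exact_mod_cast Units.ne_zero (Equiv.Perm.sign i.cycleRange.symm)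

/-- **If `det A ≠ 0` and the fibre class is killed by the eigenwave, then `B = 0`.** [cite: Zharkov2020TropicalWeil, p. 2] -/
theorem upperRight_eq_zero_of_fibreTable_eigenwave (lo hi : Fin 4 → Fin (2 * 4)) (hlo : ∀ i, (lo i : ℕ) = i)
    (hhi : ∀ i, (hi i : ℕ) = i + 4) (Q : Matrix (Fin (2 * 4)) (Fin (2 * 4)) ℝ)
    (hA : (Q.submatrix hi hi).det ≠ 0)
    (h : ∀ (K' : Fin 5 → Fin (2 * 4)) (J' : Fin 3 → Fin (2 * 4)),
      ∑ m : Fin 5, (-1 : ℝ) ^ (m : ℕ) * (𝔉⟦Q, hi⟧) (fun a => K' (m.succAbove a)) (Fin.cons (K' m) J') = 0) :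
    ∀ i j : Fin 4, Q (lo i) (hi j) = 0 := by
  intro k
  -- every `det (A with row i replaced by B_k)` vanishes
  have hrow : ∀ i : Fin 4, ((Q.submatrix hi hi).updateRow i (fun j => Q (lo k) (hi j))).det = 0 := by
    intro i
    have hs := h (Fin.cons (hi i) (fun a => if a = i then lo k else hi a)) (fun t => hi (i.succAbove t))
    rw [eigenwave_sum_special lo hi hlo hhi] at hs
    rcases mul_eq_zero.mp hs with h0 | h0
    · exact h0
    · exact absurd h0 (det_fibreFrame_submatrix_cons_ne_zero hi hhi i)
  -- Cramer: `adj(Aᵀ) · B_k = 0`, and `adj(Aᵀ)` is invertible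
  have hcr : Matrix.cramer (Q.submatrix hi hi)ᵀ (fun j => Q (lo k) (hi j)) = 0 := by
    funext i
    rw [Matrix.cramer_apply, Matrix.updateCol_transpose, Matrix.det_transpose, hrow, Pi.zero_apply]
  rw [Matrix.cramer_eq_adjugate_mulVec] at hcr
  have hdet : ((Q.submatrix hi hi)ᵀ.adjugate).det ≠ 0 := by
    rw [Matrix.det_adjugate, Matrix.det_transpose, Fintype.card_fin]
    exact pow_ne_zero _ hA
  have hb := Matrix.eq_zero_of_mulVec_eq_zero hdet hcr
  intro j
  exact congrFun hb j

/-- **The vertical fibre class is a tropical Hodge class exactly on the split locus**: for `det Q[hi,hi] ≠ 0`, the table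
`⋀⁴Q · (e_hi ⊗ e_hi)` is killed by the eigenwave iff the upper-right block `Q[lo,hi]` vanishes (for a Weil period
`[[A,B],[-B,A]]`: iff `B = 0`). The rows `x⁴`, `y⁴` of Computation C (HOME `certificates/splitrigidity/`).
[cite: Zharkov2020TropicalWeil, p. 2] [cite: MikhalkinZharkov2014Eigenwave, Thm. 5.4] -/
theorem fibreTable_eigenwave_iff (lo hi : Fin 4 → Fin (2 * 4)) (hlo : ∀ i, (lo i : ℕ) = i)
    (hhi : ∀ i, (hi i : ℕ) = i + 4) (Q : Matrix (Fin (2 * 4)) (Fin (2 * 4)) ℝ) (hA : (Q.submatrix hi hi).det ≠ 0) :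
    (∀ (K' : Fin 5 → Fin (2 * 4)) (J' : Fin 3 → Fin (2 * 4)),
      ∑ m : Fin 5, (-1 : ℝ) ^ (m : ℕ) * (𝔉⟦Q, hi⟧) (fun a => K' (m.succAbove a)) (Fin.cons (K' m) J') = 0) ↔
    ∀ i j : Fin 4, Q (lo i) (hi j) = 0 :=
  ⟨upperRight_eq_zero_of_fibreTable_eigenwave lo hi hlo hhi Q hA,
    fun hB K' J' => fibreTable_eigenwave_of_upperRight_eq_zero lo hi hlo hhi Q hB K' J'⟩

end

end Summit.HodgeConjecture.HodgeConjecture.Theorems.TropicalWeilVanishing.SplitRigidity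

end
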